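import Summits.QuantumFields.QCD.Theorems.QuarksAsStableActionStableActionBridgeDiracMatrixTransferForm
import Summits.QuantumFields.QCD.Theorems.QuarksAsStableActionStableActionBridgeSupertraceTransferForm

/-!
# Lüscher's supertrace formula for the `N_f`-flavour Wilson–Dirac determinant
(crux `QuarksAsStableAction.StableActionBridge`, item stmt-QuantumFields-9737, line `Sketch`;
registered stub `det_diracMatrix_eq_supertrace_fermionSliceOp`, the `N_f`-flavour version of
capstone B of the F3 dictionary)

For an `SU(3)` gauge field `U` on the four-torus `(ℤ/L)⁴` (`L ≥ 1`) and `N_f` flavours of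
`r = 1` Wilson quarks of bare masses `m_f > −1` in the fundamental representation, the
determinant of the STATEMENT's flavour-diagonal Wilson–Dirac matrix `D(U) = diracMatrix U mq` is
the Fock-space SUPERTRACE, over the `N_f`-flavour slice Fock space, of the time-ordered product of
Smit's fermionic transfer operators `T̂_F(U_t) = (det A(U_t))² Γ(M_F(U_t))` (`fermionSliceOp`,
Smit (6.91)) interleaved with the Gauss-law gauge rotations `Γ(G_t)` (`fockGaugeAct`,
Smit §4.6 (4.125)–(4.127)) by the temporal links leaving slice `t`:

  `det D(U) = STr ∏_{t=0}^{L−1} T̂_F(U_t) Γ(G_t) = Σ_s (−1)^{#s} ⟨s| ∏_t T̂_F(U_t) Γ(G_t) |s⟩`.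

Time is PERIODIC for the tree's `wilsonDirac` (and hence for each flavour block of
`diracMatrix`, Montvay–Münster §5.1), whence the fermion-number twist `(−1)^F = (−1)^N̂`
(Smit App. C (C.70): the Grassmann integral with periodic time computes `Tr[(−1)^N̂ ⋯]`, the
antiperiodic one the trace).

Assembly: the `N_f`-flavour capstone A (`det_diracMatrix_eq_smit_transfer_form`) gives
`det D(U) = (∏_t det A(U_t)²) · det (1 − ∏_t M_F(U_t) G_t)`; the finite product over `ZMod L` is
the ordered product over `List.range L` (`SupertraceTransferForm.prod_univ_zmod_eq`); and the
abstract supertrace form `SupertraceTransferForm.supertrace_form` — `det (1 − X) =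
det (1 − reindex X)` along the enumeration `sliceQuarkEquiv` of the `N_f`-flavour slice quark
modes, `det (1 − Y) = Σ_s (−1)^{#s} Γ(Y)_{ss}`, and `Γ ∘ reindex` multiplicative and unital, so it
passes through the ordered product with the Dirac-sea scalars `det A(U_t)²` collecting in front —
is generic in the mode index type, hence applies verbatim with `N_f` flavours.  Pure theorem file
(no definitions).

References: M. Lüscher, Commun. Math. Phys. 54 (1977) 283 [Luscher1977, pp. 283–292]; J. Smit,
*Introduction to Quantum Fields on a Lattice*, §6.5 (6.87)–(6.91) and App. C (C.70)
[Smit2023, §6.5 (6.87)–(6.91), App. C (C.70)]; I. Montvay and G. Münster, *Quantum Fields on a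
Lattice*, §5.1 [MontvayMunster1994, §5.1].
-/

noncomputable section

namespace Summit.QuantumFields.QCD.Cruxes.StableActionBridge.Sketch

open MeasureTheory Matrix Literature.MathematicalPhysics.QuantumFieldTheory
  Literature.MathematicalPhysics.QuantumLattice
open Literature.Probability.LatticeModels (TorusSite)

/-- **Stub `det_diracMatrix_eq_supertrace_fermionSliceOp` of line `Sketch` (the `N_f`-flavour
capstone B of the F3 dictionary): Lüscher's supertrace formula.**  For an `SU(3)` gauge field `U`
on the four-torus `(ℤ/L)⁴` and `N_f` flavours of `r = 1` Wilson quarks of bare masses `m_f > −1`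
(fundamental representation), the determinant of the flavour-diagonal Wilson–Dirac matrix
`D(U) = diracMatrix U mq` is
`det D(U) = Σ_s (−1)^{#s} ⟨s| ∏_{t=0}^{L−1} T̂_F(U_t) Γ(G_t) |s⟩ = STr ∏_t T̂_F(U_t) Γ(G_t)`, with
`U_t` the slice configuration `(x⃗, j) ↦ U((t, x⃗), j+1)`, `T̂_F(U_t) = fermionSliceOp U_t mq`
Smit's `N_f`-flavour fermionic transfer operator (6.91) and
`Γ(G_t) = fockGaugeAct (y ↦ U((t, y), 0))` the Fock-space gauge rotation by the temporal links
(Gauss law); periodic time gives the `(−1)^F`-twisted trace.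
[cite: Luscher1977, pp. 283–292] [cite: Smit2023, §6.5 (6.87)–(6.91), App. C (C.70)]
[cite: MontvayMunster1994, §5.1] -/
theorem det_diracMatrix_eq_supertrace_fermionSliceOp : ∀ (Nf L : ℕ) [NeZero L] (U : GaugeConfig 4 L (Matrix.specialUnitaryGroup (Fin 3) ℂ)) (mq : Fin Nf → ℝ), (∀ f, -1 < mq f) → (diracMatrix U mq).det = ∑ s : Finset (SliceFermiIdx Nf L), (-1 : ℂ) ^ s.card * (((List.range L).map fun i : ℕ => fermionSliceOp (fun e : Edge 3 L => U ((Fin.cons (i : ZMod L) e.1 : TorusSite 4 L), e.2.succ)) mq * fockGaugeAct (Nf := Nf) (fun y : TorusSite 3 L => U ((Fin.cons (i : ZMod L) y : TorusSite 4 L), 0))).prod) s s := by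
  intro Nf L _ U mq hm
  -- `N_f`-flavour capstone A: `det D(U) = (∏_t det A(U_t)²) · det (1 − ∏_t M_F(U_t) G_t)`, the
  -- `ZMod L`-product rewritten as the ordered product over `List.range L`
  rw [det_diracMatrix_eq_smit_transfer_form Nf L U mq hm,
    SupertraceTransferForm.prod_univ_zmod_eq]
  -- `det (1 − Y) = STr Γ(reindex Y)` and `Γ ∘ reindex` through the ordered product
  exact SupertraceTransferForm.supertrace_form (sliceQuarkEquiv (Nf := Nf) (S := L))
    (fun i : ℕ => (sliceMassHop
      (fun e : Edge 3 L => U ((Fin.cons (i : ZMod L) e.1 : TorusSite 4 L), e.2.succ)) mq).det ^ 2)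
    (fun i : ℕ => fermionSliceMatrix
      (fun e : Edge 3 L => U ((Fin.cons (i : ZMod L) e.1 : TorusSite 4 L), e.2.succ)) mq)
    (fun i : ℕ => sliceGaugeRot (Nf := Nf)
      (fun y : TorusSite 3 L => U ((Fin.cons (i : ZMod L) y : TorusSite 4 L), 0)))
    L

end Summit.QuantumFields.QCD.Cruxes.StableActionBridge.Sketch

end
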